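import Literature.NumberTheory.EllipticCurves.PadicLogEulerOperatorProofs
import Literature.NumberTheory.EllipticCurves.FrobeniusTraceBaseChange
import Literature.NumberTheory.EllipticCurves.MinimalModelReduction
import Literature.NumberTheory.EllipticCurves.ModifiedTamagawaProduct
import Literature.NumberTheory.EllipticCurves.IsogenyFrobeniusTraceProofs
import Literature.NumberTheory.EllipticCurves.OrdinaryPrimesProofs
import Literature.NumberTheory.EllipticCurves.LFunctionPrimeCoeff
import Literature.NumberTheory.DiophantineGeometry.LocalReductionMinimalityProofs
import Literature.NumberTheory.GaloisRepresentations.ArtinFormalismInductionProofs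
import HarnessLib

/-!
# The point count of the reduction of `W_ℤ ⊗ 𝒪_w` at a place `w ∣ p` of good reduction:
# `#Ẽ(k_w) = p^f + 1 − D_f(a_p; p)` (Silverman V.2.3.1 over the residue field of a completion)

`Proofs` file (theorems only) in topic `NumberTheory/EllipticCurves`, namespace
`Literature.NumberTheory.EllipticCurves.EulerLattice` (sequel of `PadicLogEulerOperatorProofs`; cell
`bsd-addord`, seat w2-acc3 gen 7, route W2, support item 20397; PART C of the E-side lattice lemma
`log_ω E(K) = E_p(φ)⁻¹𝒪_K`): the arithmetic count that matches the index of the Euler lattice.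

For `W/ℚ` globally minimal with `p ∤ Δ_min(W)`, a number field `L : Type` and a finite place `w` of
`L` with `p ∈ w` of residue degree `f = f(w|p)`:

* `exists_place_under` — the place of `ℚ` under `w` is the place of `p`;
* `natCard_point_reduction_model` — **`#Ẽ(k_w) = p^f + 1 − D_f(a_p; p)`** for the reduction
  `(W_ℤ ⊗ 𝒪_w) mod 𝔪_w` of the integral model over `𝒪_w = w.adicCompletionIntegers L` (the curve
  whose points the reduction homomorphism of `PadicLogEulerOperatorProofs` lands in), `a_p =
  W.frobeniusTrace p`, `D_f = Polynomial.dickson 1 p f` (`D_f(α + β; αβ) = α^f + β^f`).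

Assembly of tree theorems: the trace of Frobenius of `W ⊗ L` at `w` is `D_f(a_v(W); q_v)`
(`WeierstrassCurve.frobeniusTraceAt_baseChange_eq_eval_dickson`, Silverman V.2.3.1 via `ℓ`-adic
representations), `a_v = a_p` (`frobeniusTraceAt_eq_frobeniusTrace`), `q_v = p`, `q_w = p^f`
(`residueCard_eq_pow_inertiaDeg_of_under_eq`), `a_w = q_w + 1 − #Ẽ_w(k_w)` (`frobeniusTraceAt_def`),
and Mathlib's chosen minimal model at `w` has as many `k_w`-points as the model `W_ℤ ⊗ 𝒪_w`, which
is minimal with unit discriminant (`natCard_point_reduction_minimal`, Silverman VII.1.3(b);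
`isMinimalAt_of_lt_valuation_Δ_holds`, `valuation_Δ_baseChange_int_eq_one`,
`integralModel_eq_of_baseChange_eq`).  Nothing here proves BSD or closes an item.

## References

* [SilvermanAEC2009] J. H. Silverman, *The Arithmetic of Elliptic Curves*, 2nd ed. (2009):
  Thm. V.2.3.1 and its proof (`#E(𝔽_{qⁿ}) = qⁿ + 1 − αⁿ − βⁿ`), Prop. VII.1.3(b), Prop. VII.5.1(a).
* [NeukirchANT1999] J. Neukirch, *Algebraic Number Theory* (1999), Ch. I §8 (primes in extensions,
  residue degree).
-/
noncomputable section

open scoped Classical NNReal NumberField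

namespace Literature.NumberTheory.EllipticCurves.EulerLattice

open NumberField IsDedekindDomain _root_.WeierstrassCurve Literature.NumberTheory.EllipticCurves
  Rat.HeightOneSpectrum

variable {L : Type} [Field L] [NumberField L] (w : HeightOneSpectrum (𝓞 L))
  (W : WeierstrassCurve ℚ) [W.IsElliptic] [W.IsGloballyMinimal] {p : ℕ} [hp : Fact p.Prime]

/-- The place `v` of `ℚ` under a place `w ∋ p` of `L` is the place of `p`:
`w ∩ 𝓞 ℚ = v`, `primesEquiv v = p`. [cite: NeukirchANT1999, Ch. I §8] -/
theorem exists_place_under (hw : ((p : ℕ) : 𝓞 L) ∈ w.asIdeal) :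
    ∃ v : HeightOneSpectrum (𝓞 ℚ), w.asIdeal.under (𝓞 ℚ) = v.asIdeal ∧ (primesEquiv v : ℕ) = p := by
  have hprime : (w.asIdeal.under (𝓞 ℚ)).IsPrime := Ideal.IsPrime.under (𝓞 ℚ) w.asIdeal
  have hmem : ((p : ℕ) : 𝓞 ℚ) ∈ w.asIdeal.under (𝓞 ℚ) := by
    rw [Ideal.under_def, Ideal.mem_comap, map_natCast]; exact hw
  have hne : w.asIdeal.under (𝓞 ℚ) ≠ ⊥ := by
    intro h
    rw [h, Ideal.mem_bot, Nat.cast_eq_zero] at hmem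
    exact hp.out.ne_zero hmem
  let v : HeightOneSpectrum (𝓞 ℚ) := ⟨w.asIdeal.under (𝓞 ℚ), hprime, hne⟩
  have hv : v = (primesEquiv (R := 𝓞 ℚ)).symm ⟨p, hp.out⟩ :=
    (natCast_mem_asIdeal_iff_eq_primesEquiv_symm v hp.out).mp hmem
  refine ⟨v, rfl, ?_⟩
  rw [hv, Equiv.apply_symm_apply]

/-- **`#Ẽ(k_w) = p^f + 1 − D_f(a_p; p)`** for the reduction at a place `w ∣ p` (`f` the residue
degree) of the integral model `W_ℤ ⊗ 𝒪_w` of a globally minimal `W/ℚ` with good reduction at `p`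
(`D_f = Polynomial.dickson 1 p f`, `D_f(α+β; αβ) = α^f + β^f`; Silverman V.2.3.1:
`#E(𝔽_{p^f}) = p^f + 1 − α^f − β^f`).  Assembled from the tree: the trace of Frobenius of `W ⊗ L` at
`w` is `D_f(a_p; p)` (`frobeniusTraceAt_baseChange_eq_eval_dickson`), `a_w = q_w + 1 − #Ẽ_w(k_w)` with
`q_w = p^f`, and Mathlib's chosen minimal model at `w` has as many points as the (minimal, unit
discriminant) model `W_ℤ ⊗ 𝒪_w` (`natCard_point_reduction_minimal`).
[cite: SilvermanAEC2009, Thm. V.2.3.1 (proof) and Prop. VII.1.3(b)] -/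
theorem natCard_point_reduction_model (hw : ((p : ℕ) : 𝓞 L) ∈ w.asIdeal)
    (hΔ : ¬ (p : ℤ) ∣ minimalDiscriminantInt W) :
    (Nat.card (((integralModelInt W).map (Int.castRingHom (w.adicCompletionIntegers L))).map
        (IsLocalRing.residue (w.adicCompletionIntegers L))).toAffine.Point : ℤ) =
      (p : ℤ) ^ w.asIdeal.inertiaDeg (𝓞 ℚ) + 1 -
        (Polynomial.dickson 1 (p : ℤ) (w.asIdeal.inertiaDeg (𝓞 ℚ))).eval (W.frobeniusTrace p) := by
  obtain ⟨v, hwv, hvp⟩ := exists_place_under w hw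
  subst hvp
  haveI : Fact (primesEquiv v : ℕ).Prime := ⟨(primesEquiv v).2⟩
  -- good reduction of `W` at `v`; the Dickson formula for the trace at `w`
  have hgood : W.HasGoodReductionAt v := by
    rw [← hasGoodReductionAtPrime_iff_hasGoodReductionAt_ringOfIntegers]
    exact hasGoodReductionAtPrime_of_not_dvd W _ hΔ
  have htrace := frobeniusTraceAt_baseChange_eq_eval_dickson W L hwv hgood
  rw [frobeniusTraceAt_eq_frobeniusTrace, frobeniusTraceAt_def] at htrace
  -- `q_w = p^f`, `q_v = p`
  have hqv : v.residueCard = (primesEquiv v : ℕ) := by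
    rw [← natCard_residueField_eq_residueCard, natCard_residueField_adicCompletionIntegers v]
  have hqw : Nat.card (IsLocalRing.ResidueField (w.adicCompletionIntegers L)) =
      (primesEquiv v : ℕ) ^ w.asIdeal.inertiaDeg (𝓞 ℚ) := by
    rw [natCard_residueField_eq_residueCard, Literature.NumberTheory.GaloisRepresentations.residueCard_eq_pow_inertiaDeg_of_under_eq hwv, hqv]
  rw [hqw, hqv] at htrace
  -- the two reductions have equally many points: both equations are minimal at `w`
  set R := w.adicCompletionIntegers L with hR
  set W₀ : WeierstrassCurve R := (integralModelInt W).map (Int.castRingHom R) with hW₀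
  set X : WeierstrassCurve (w.adicCompletion L) := (W.baseChange L).baseChange (w.adicCompletion L) with hX
  have hWL : (integralModelInt W).baseChange L = W.baseChange L := by
    conv_rhs => rw [← map_integralModelInt W]
    rw [baseChange, baseChange, WeierstrassCurve.map_map]
    exact congrArg (integralModelInt W).map (RingHom.ext_int _ _)
  have hXW₀ : W₀.baseChange (w.adicCompletion L) = X := by
    rw [hX, hW₀, ← hWL]
    simp only [baseChange, WeierstrassCurve.map_map]
    exact congrArg (integralModelInt W).map (RingHom.ext_int _ _)
  have hint : (W.baseChange L).IsIntegralAt w := by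
    rw [← hWL]; exact isIntegralAt_baseChange_intModel (integralModelInt W) w
  have hval : w.valuation L (W.baseChange L).Δ = 1 := by
    rw [← hWL]
    exact valuation_Δ_baseChange_int_eq_one (integralModelInt W) w (primesEquiv v).2 hw hΔ
  haveI hmin : X.IsMinimal R := by
    have h : (W.baseChange L).IsMinimalAt w := by
      refine isMinimalAt_of_lt_valuation_Δ_holds hint ?_
      rw [hval, ← WithZero.exp_zero, WithZero.exp_lt_exp]
      norm_num
    exact h
  haveI hintX : X.IsIntegral R := hint
  have hΔX : X.Δ ≠ 0 := by
    rw [hX, baseChange, map_Δ, baseChange, map_Δ]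
    exact (_root_.map_ne_zero _).mpr ((_root_.map_ne_zero _).mpr W.isUnit_Δ.ne_zero)
  have h1 : Nat.card ((W.baseChange L).reductionAt w).toAffine.Point =
      Nat.card (X.reduction R).toAffine.Point := by
    rw [← natCard_point_reduction_minimal X hΔX]
    rfl
  have h2 : X.integralModel R = W₀ := integralModel_eq_of_baseChange_eq X W₀ hXW₀
  have h3 : X.reduction R = W₀.map (IsLocalRing.residue R) := by
    rw [reduction, h2]
  rw [h1, h3] at htrace
  -- `a_w = q_w + 1 − #`, solve for `#`
  push_cast at htrace ⊢
  linarith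

end Literature.NumberTheory.EllipticCurves.EulerLattice
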